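import Literature.AnabelianGeometry.EtaleTheta.Discharge.Sec5FirstDatumThetaTwistTower
import Literature.AnabelianGeometry.EtaleTheta.Discharge.Sec5RootDivisorInvarianceOfKernel
import HarnessLib

/-!
# [EtTh] §5 p.331 / Prop. 4.3 (i) p.317 at the FIRST §5 DATUM over the fourth tower model: the displayed binder `hinvp` DISCHARGED from the
# level clause `hM : φ(ιX(Π^tp_Ÿ)) ⊆ V_n` ALONE (no hypothesis on the polar divisor)

S. Mochizuki, *The étale theta function …*, Publ. RIMS **45** (2009) [MochizukiEtTh2009], proof of Prop. 4.3 (i) p.317 (PDF p.91) («this follows from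
the fact that [by definition] `H` acts trivially on `A_⊙^bs` [together with the fact the monoid `Φ(A_N)` is torsion-free!]»), §5 p.331 (PDF p.105).
[cite: MochizukiEtTh2009, Prop 4.3 (i) p.317 (PDF p.91)]  PAGE CONVENTION for [EtTh]: «printed N (PDF p.M)», N = M + 226.

PROOF-ONLY rider (theorems only; abc-iut cell, layer L2, seat abc-iut-L2-d2 gen 8) to abc-iut-L2-t4's `Discharge/Sec5FirstDatumThetaTwistTower.lean`
(p513309, junction FILE 1), which assembles `firstDatum … hinvp` with `hinvp` DISPLAYED and separately takes `hM` for `Facts`.  By abc-iut-L2-t3's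
`ThetaFrobenioid.hinvp_of_hH` (`Sec5RootDivisorInvarianceOfKernel`, gen 7) `hinvp` follows from `hH : ιX(Π^tp_Ÿ) ⊆ H_⊙` alone, and FILE 1's
own `hH_settingTheta_of_forall_mem` gives `hH ⟸ hM`; so at this datum **`hinvp ⟸ hM`** with nothing else — ONE display clause instead of two.
Consumed BY NAME, nothing restated: `settingTheta`, `hH_settingTheta_of_forall_mem`, `settingTheta_galoisSurjNatural`, `isDivisorial_full`
(p513309), `hinvp_of_hH` (L2-t3), this seat's `thetaUnit` / `thetaFractionPair` (p507274).
* **`hinvp_settingTheta_of_hM`** — for every nested root datum `(Rl, Rt)` over the theta function in `settingTheta R S n X φ hφ`, any `pullFrac`, any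
  §2 datum `T`/`ιX`: `hM ⟹ hinvp`;
* **`hinvp_settingTheta_of_hH`** — the same from `hH` (for sockets where `hH` is a theorem by construction).
HONEST FRAMING: class-(b) combinatorial DESIGN carrier; `φ` onto `Compat₃′` design-only (R1257); `hM` remains a HYPOTHESIS on the displayed `φ`
(a level clause); nothing here bears on [IUTchIII] Cor. 3.12; no side taken; typed ≠ proved.
-/

noncomputable section

namespace Literature.AnabelianGeometry.EtaleTheta

open CategoryTheory Opposite Function Literature.AlgebraicGeometry.Frobenioids Literature.AlgebraicGeometry.Frobenioids.QuasiTemperoid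
  Literature.AnabelianGeometry.SemiGraphs LogDivisorModel LogDivisorModel.GaloisAction LogDivisorTower TateTowerKummerTwistRShear
  LogDivisorModel.TateTowerThetaTwist

namespace ThetaTwistTowerTempered

variable (R S : ((ConnectedPart (BTemp (Compat 3 thetaShear)))ᵒᵖ ⥤ CommMonCat.{0}) → Prop) (n : ℕ) {K : Type 1} [Field K]
  (X : SemiGraphs.TemperedArithmeticGroup.{1} K) (φ : X.Pi →ₜ* Compat 3 thetaShear) (hφ : Function.Surjective φ)
  {lv N : ℕ+} (T : ThetaEnvData.{0} N)
  {pullFrac : ∀ {A A' : (ThetaTwistTowerTempered.temperedFrobenioid R S).category} (_ : A' ⟶ A),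
    (ThetaTwistTowerTempered.temperedFrobenioid R S).biratUnitsModel A → (ThetaTwistTowerTempered.temperedFrobenioid R S).biratUnitsModel A'}
  (Rl : (settingTheta R S n X φ hφ).NthRoot (thetaUnit R S n)
    (thetaFractionPair R S n X _ _ _ (fun _ _ _ => True) _ (isFrobeniusTrivial_Aodot R S n) (isGaloisObj_Aodot_base R S n)) lv pullFrac)
  (Rt : (settingTheta R S n X φ hφ).NthRoot Rl.root Rl.pair N pullFrac) (ιX : T.PiX ≃ₜ* X.Pi)

/-- **`hinvp ⟸ hH`** at the first §5 datum's setting: for every `y ∈ Π^tp_Ÿ`, `Φ(ρ_{A_N}(ιX y))(Div s^⊔_N) = Div s^⊔_N`, from `hH : ιX(Π^tp_Ÿ) ⊆ H_⊙`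
alone (abc-iut-L2-t3's `hinvp_of_hH`; `Φ` divisorial and the outer naturality are FILE 1's theorems). [cite: MochizukiEtTh2009, Prop 4.3 (i) p.317 (PDF p.91)] -/
theorem hinvp_settingTheta_of_hH (hH : ∀ y : T.PiX, y ∈ T.PiYdd → ιX y ∈ (settingTheta R S n X φ hφ).Hodot) (y : T.PiX) (hy : y ∈ T.PiYdd) :
    pull (ThetaTwistTowerTempered.temperedFrobenioid R S).divisorMonoid
        ((settingTheta R S n X φ hφ).galoisSurj Rt.AN.base Rt.αData.isGalois (ιX y)).hom (ModelFrobenioid.div Rt.pair.den) =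
      ModelFrobenioid.div Rt.pair.den :=
  ThetaFrobenioid.hinvp_of_hH Rt ιX (fun W => isDivisorial_full R S W) (settingTheta_galoisSurjNatural R S n X φ hφ) hH y hy

/-- **`hinvp ⟸ hM`**: the displayed binder `hinvp` of FILE 1's `firstDatum` follows from the level clause `hM : φ(ιX(Π^tp_Ÿ)) ⊆ V_n` ALONE
(`hH ⟸ hM` by FILE 1's `hH_settingTheta_of_forall_mem`) — so `firstDatum … (hinvp_settingTheta_of_hM … hM)` needs no divisor hypothesis.
[cite: MochizukiEtTh2009, Prop 4.3 (i) p.317 (PDF p.91); §5 p.331 (PDF p.105)] -/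
theorem hinvp_settingTheta_of_hM (hM : ∀ y : T.PiX, y ∈ T.PiYdd → φ (ιX y) ∈ vOpenNormal 3 thetaShear n) (y : T.PiX) (hy : y ∈ T.PiYdd) :
    pull (ThetaTwistTowerTempered.temperedFrobenioid R S).divisorMonoid
        ((settingTheta R S n X φ hφ).galoisSurj Rt.AN.base Rt.αData.isGalois (ιX y)).hom (ModelFrobenioid.div Rt.pair.den) =
      ModelFrobenioid.div Rt.pair.den :=
  hinvp_settingTheta_of_hH R S n X φ hφ T Rl Rt ιX (hH_settingTheta_of_forall_mem R S n X φ hφ ιX T.PiYdd hM) y hy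

/-- **The first §5 datum with `hinvp` DISCHARGED from `hM`**: FILE 1's `firstDatum` instantiated at `hinvp := hinvp_settingTheta_of_hM … hM` is
(trivially) available — recorded as an inhabitation so that the junction books may strike `hinvp` from the displayed list whenever `hM` is listed.
[cite: MochizukiEtTh2009, §5 p.331 (PDF p.105)] -/
theorem nonempty_firstDatum_of_hM (odd_l : Odd (lv : ℕ)) (K' : Type) [Field K']
    (constEmb : K'ˣ →* (ThetaTwistTowerTempered.temperedFrobenioid R S).biratUnitsModel Rt.BN) (constEmb_injective : Injective constEmb)
    (hM : ∀ y : T.PiX, y ∈ T.PiYdd → φ (ιX y) ∈ vOpenNormal 3 thetaShear n) :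
    Nonempty (ThetaFrobenioid.{0} (settingTheta R S n X φ hφ).C (ConnectedPart (BTemp (Compat 3 thetaShear)))) :=
  ⟨firstDatum R S n X φ hφ T Rl Rt odd_l ιX K' constEmb constEmb_injective
    (fun y hy => hinvp_settingTheta_of_hM R S n X φ hφ T Rl Rt ιX hM y hy)⟩

end ThetaTwistTowerTempered

end Literature.AnabelianGeometry.EtaleTheta

end
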